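import Literature.AnabelianGeometry.SemiGraphs.FreeGroupsAndActionsProofs2
import Literature.AnabelianGeometry.SemiGraphs.SemiGraphLocal
import Literature.AnabelianGeometry.SemiGraphs.SubdivisionLemmas
import Literature.GroupTheory.CombinatorialGroupTheory.FreeGroupResiduallyFinite

/-!
# Free groups and finite group actions on semi-graphs: proofs — Cor. 1.7 and Lemma 1.8 (i) ([SemiAnbd] §1, pp. 20–21)

Mochizuki, *Semi-graphs of Anabelioids*, Publ. RIMS **42** (2006) 221–322, §1, author's manuscript
pp. 20–21 [cite: MochizukiSemiAnbd2006, §1 pp.20-21].  Proof-only companion of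
`FreeGroupsAndActions.lean` (abc-iut-L3-t1, p404224); the named facts are discharged AS TYPED:

* `corollary_1_7_holds` — Corollary 1.7 (Residual Finiteness of Free Groups), a three-line wrapper
  of the tree's `Literature.GroupTheory.CombinatorialGroupTheory.exists_finiteIndex_normal_notMem`
  (free groups are residually finite, by the permutation representation attached to a reduced word);
* `lemma_1_8_i_holds` — Lemma 1.8 (i): in a connected semi-graph with an action of a finite group
  `Γ`, every finite sub-semi-graph is contained in a finite connected `Γ`-stable sub-semi-graph.  As
  printed ("we may assume that `G'` is connected and contains the `Γ`-orbit of some vertex … take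
  `G''` to be the `Γ`-orbit of `G'`"): we join a base point `x₀` of the barycentric subdivision to
  every node of the given sub-semi-graph and to every translate of `x₀` by chosen walks, take the
  union `W` of their supports and the union `S` of `W` with its `Γ`-translates (finite, `Γ`-stable,
  and connected through `x₀`), and saturate `S` into a sub-semi-graph.

Tools: walks of `G.subdivision` running over a sub-semi-graph lift to its own subdivision
(`Subgraph.reachable_of_walk`); a sub-semi-graph mapped into itself by every group element is
stabilized (`Subgraph.isStabilized_of_mapsTo`).  Lemma 1.8 (ii)(b), (ii)(c) are abc-iut-L3-t11's
`FreeGroupsAndActionsProofs2/3.lean` (whose `nodeMap` API is used here); (ii)(a) is in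
`FreeGroupsAndActionsProofs4.lean`.
-/

namespace Literature.AnabelianGeometry.SemiGraphs

open CategoryTheory

universe u

/-! ### Corollary 1.7: residual finiteness of free groups (p. 20) -/

/-- DISCHARGE of the named fact `corollary_1_7` ([SemiAnbd] Corollary 1.7, Residual Finiteness of
Free Groups: "Every discrete free group `F` injects into its profinite completion"): every `x ≠ 1`
of a free group lies outside some normal subgroup of finite index — the tree's
`exists_finiteIndex_normal_notMem` (Schreier; Lyndon–Schupp I §3). [cite: MochizukiSemiAnbd2006, Cor. 1.7 p.20] -/
theorem corollary_1_7_holds : corollary_1_7.{u} :=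
  fun _ x hx => Literature.GroupTheory.CombinatorialGroupTheory.exists_finiteIndex_normal_notMem x hx

namespace SemiGraph

variable {G : SemiGraph.{u}}

/-! ### The nodes of a sub-semi-graph inside the nodes of `G` -/

/-- A vertex-node lies over the sub-semi-graph `K` iff the vertex belongs to `K`.
[cite: MochizukiSemiAnbd2006, §1 p.12] -/
theorem Subgraph.inl_mem_range_iff (K : G.Subgraph) (v : G.Vertex) :
    (Sum.inl v : G.Node) ∈ Set.range (Sum.map K.ι.vertexMap (Sum.map K.ι.edgeMap K.ι.branchMap)) ↔
      v ∈ K.verts := by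
  constructor
  · rintro ⟨x, hx⟩
    rcases x with x | x | x
    · have h : K.ι.vertexMap x = v := by simpa using hx
      have h' : x.1 = v := h
      exact h' ▸ x.2
    · simp at hx
    · simp at hx
  · intro h
    exact ⟨Sum.inl ⟨v, h⟩, rfl⟩

/-- An edge-node lies over the sub-semi-graph `K` iff the edge belongs to `K`.
[cite: MochizukiSemiAnbd2006, §1 p.12] -/
theorem Subgraph.edge_mem_range_iff (K : G.Subgraph) (e : G.Edge) :
    (Sum.inr (Sum.inl e) : G.Node) ∈
        Set.range (Sum.map K.ι.vertexMap (Sum.map K.ι.edgeMap K.ι.branchMap)) ↔ e ∈ K.edges := by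
  constructor
  · rintro ⟨x, hx⟩
    rcases x with x | x | x
    · simp at hx
    · have h : K.ι.edgeMap x = e := by simpa using hx
      have h' : x.1 = e := h
      exact h' ▸ x.2
    · simp at hx
  · intro h
    exact ⟨Sum.inr (Sum.inl ⟨e, h⟩), rfl⟩

/-- A branch-node lies over the sub-semi-graph `K` iff its edge belongs to `K`.
[cite: MochizukiSemiAnbd2006, §1 p.12] -/
theorem Subgraph.branch_mem_range_iff (K : G.Subgraph) (b : G.Branch) :
    (Sum.inr (Sum.inr b) : G.Node) ∈
        Set.range (Sum.map K.ι.vertexMap (Sum.map K.ι.edgeMap K.ι.branchMap)) ↔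
      G.edgeOf b ∈ K.edges := by
  constructor
  · rintro ⟨x, hx⟩
    rcases x with x | x | x
    · simp at hx
    · simp at hx
    · have h : K.ι.branchMap x = b := by simpa using hx
      have h' : x.1 = b := h
      exact h' ▸ x.2
  · intro h
    exact ⟨Sum.inr (Sum.inr ⟨b, h⟩), rfl⟩

/-- The node map of the inclusion of a sub-semi-graph is injective.
[cite: MochizukiSemiAnbd2006, §1 p.12] -/
theorem Subgraph.node_map_injective (K : G.Subgraph) :
    Function.Injective (Sum.map K.ι.vertexMap (Sum.map K.ι.edgeMap K.ι.branchMap) :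
      K.toSemiGraph.Node → G.Node) :=
  Sum.map_injective.mpr ⟨Subtype.val_injective,
    Sum.map_injective.mpr ⟨Subtype.val_injective, Subtype.val_injective⟩⟩

/-- The inclusion of a sub-semi-graph reflects the incidence relation of the subdivisions (conditions
(b), (c) of p. 12: the coincidence maps of the sub-semi-graph are the restrictions).
[cite: MochizukiSemiAnbd2006, §1 p.12] -/
theorem Subgraph.nodeRel_reflect (K : G.Subgraph) {x y : K.toSemiGraph.Node}
    (h : G.NodeRel (Sum.map K.ι.vertexMap (Sum.map K.ι.edgeMap K.ι.branchMap) x)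
      (Sum.map K.ι.vertexMap (Sum.map K.ι.edgeMap K.ι.branchMap) y)) :
    K.toSemiGraph.NodeRel x y := by
  rw [nodeRel_iff] at h
  rcases h with ⟨c, h1, h2⟩ | ⟨c, w, hc, h1, h2⟩
  · rcases x with x | x | x
    · simp at h1
    · rcases y with y | y | y
      · simp at h2
      · simp at h2
      · have hx : K.ι.edgeMap x = G.edgeOf c := by simpa using h1
        have hy : K.ι.branchMap y = c := by simpa using h2
        have hx' : x.1 = G.edgeOf c := hx
        have hy' : y.1 = c := hy
        have hxy : K.toSemiGraph.edgeOf y = x := Subtype.ext (by rw [hx', ← hy']; rfl)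
        rw [← hxy]
        exact NodeRel.edge_branch y
    · simp at h1
  · rcases x with x | x | x
    · simp at h1
    · simp at h1
    · rcases y with y | y | y
      · have hx : K.ι.branchMap x = c := by simpa using h1
        have hy : K.ι.vertexMap y = w := by simpa using h2
        have hx' : x.1 = c := hx
        have hy' : y.1 = w := hy
        refine NodeRel.branch_vertex x y ((Subgraph.abuts_eq_some_iff K x y).mpr ?_)
        rw [hx', hy']
        exact hc
      · simp at h2
      · simp at h2

/-- The inclusion of a sub-semi-graph reflects adjacency of the subdivisions.
[cite: MochizukiSemiAnbd2006, §1 p.12] -/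
theorem Subgraph.adj_reflect (K : G.Subgraph) {x y : K.toSemiGraph.Node}
    (h : G.subdivision.Adj (Sum.map K.ι.vertexMap (Sum.map K.ι.edgeMap K.ι.branchMap) x)
      (Sum.map K.ι.vertexMap (Sum.map K.ι.edgeMap K.ι.branchMap) y)) :
    K.toSemiGraph.subdivision.Adj x y := by
  rw [subdivision_adj_iff] at h ⊢
  rcases h with h | h
  · exact Or.inl (K.nodeRel_reflect h)
  · exact Or.inr (K.nodeRel_reflect h)

/-- A walk of `G.subdivision` all of whose nodes lie over the sub-semi-graph `K` lifts: its
end-points are joined in the subdivision of `K`. [cite: MochizukiSemiAnbd2006, §1 p.12] -/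
theorem Subgraph.reachable_of_walk (K : G.Subgraph) {a c : G.Node} (p : G.subdivision.Walk a c)
    (hp : ∀ z ∈ p.support,
      z ∈ Set.range (Sum.map K.ι.vertexMap (Sum.map K.ι.edgeMap K.ι.branchMap)))
    (x y : K.toSemiGraph.Node)
    (hx : Sum.map K.ι.vertexMap (Sum.map K.ι.edgeMap K.ι.branchMap) x = a)
    (hy : Sum.map K.ι.vertexMap (Sum.map K.ι.edgeMap K.ι.branchMap) y = c) :
    K.toSemiGraph.subdivision.Reachable x y := by
  induction p generalizing x with
  | nil =>
    have hxy : x = y := K.node_map_injective (hx.trans hy.symm)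
    subst hxy
    exact ⟨SimpleGraph.Walk.nil⟩
  | @cons a a₁ c' hadj p ih =>
    have ha₁ : a₁ ∈ (SimpleGraph.Walk.cons hadj p).support :=
      List.mem_cons_of_mem _ p.start_mem_support
    obtain ⟨x₁, hx₁⟩ := hp a₁ ha₁
    have hadj' : K.toSemiGraph.subdivision.Adj x x₁ := K.adj_reflect (by rw [hx, hx₁]; exact hadj)
    exact hadj'.reachable.trans (ih (fun z hz => hp z (List.mem_cons_of_mem _ hz)) x₁ hx₁ hy)

/-! ### Stability under the action -/

/-- The action on nodes is multiplicative. [cite: MochizukiSemiAnbd2006, Lem. 1.8 p.20] -/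
theorem nodeMap_mul (σ τ : Aut G) (x : G.Node) : nodeMap (σ * τ) x = nodeMap σ (nodeMap τ x) := by
  rcases x with v | e | b <;> rfl

/-- A sub-semi-graph mapped into itself by every element of the group is stabilized (the inverse
elements give the reverse inclusions). [cite: MochizukiSemiAnbd2006, Lem. 1.8(i) p.20] -/
theorem Subgraph.isStabilized_of_mapsTo {Γ : Type u} [Group Γ] (ρ : Γ →* Aut G) (K : G.Subgraph)
    (hv : ∀ (γ : Γ), ∀ v ∈ K.verts, (ρ γ).hom.vertexMap v ∈ K.verts)
    (he : ∀ (γ : Γ), ∀ e ∈ K.edges, (ρ γ).hom.edgeMap e ∈ K.edges) : K.IsStabilized ρ := by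
  intro γ
  have hinv : ∀ v : G.Vertex, (ρ γ).hom.vertexMap ((ρ γ⁻¹).hom.vertexMap v) = v := by
    intro v
    rw [map_inv]
    exact congrFun (congrArg Hom.vertexMap (ρ γ).inv_hom_id) v
  have hinv' : ∀ e : G.Edge, (ρ γ).hom.edgeMap ((ρ γ⁻¹).hom.edgeMap e) = e := by
    intro e
    rw [map_inv]
    exact congrFun (congrArg Hom.edgeMap (ρ γ).inv_hom_id) e
  ext x
  · constructor
    · rintro ⟨v, hv', rfl⟩
      exact hv γ v hv'
    · intro hx
      exact ⟨_, hv γ⁻¹ x hx, hinv x⟩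
  · constructor
    · rintro ⟨e, he', rfl⟩
      exact he γ e he'
    · intro hx
      exact ⟨_, he γ⁻¹ x hx, hinv' x⟩

/-! ### Lemma 1.8 (i) -/

/-- DISCHARGE of the named fact `lemma_1_8_i` ([SemiAnbd] Lemma 1.8 (i)): `G` a connected semi-graph
with an action of a finite group `Γ`; "every finite sub-semi-graph `G'` of `G` is contained in a
finite connected sub-semi-graph `G''` of `G` that is stabilized by the action of `Γ`."
[cite: MochizukiSemiAnbd2006, Lem. 1.8(i) p.20] -/
theorem lemma_1_8_i_holds : lemma_1_8_i.{u} := by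
  intro G Γ _ _ ρ hG H hH
  classical
  have hpre : G.subdivision.Preconnected := hG.connected.preconnected
  obtain ⟨x₀⟩ := hG.connected.nonempty
  -- the graph endomorphisms of the subdivision given by the action
  let f : Γ → (G.subdivision →g G.subdivision) :=
    fun γ => ⟨nodeMap (ρ γ), fun h => subdivision_adj_nodeMap (ρ γ) h⟩
  have hmul : ∀ (γ γ' : Γ) (x : G.Node), nodeMap (ρ γ) (nodeMap (ρ γ') x) = nodeMap (ρ (γ * γ')) x := by
    intro γ γ' x
    rw [map_mul, nodeMap_mul]
  -- targets: the nodes of `H`, the base point `x₀` and its translates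
  let T₀ : Set G.Node := ((fun v : G.Vertex => (Sum.inl v : G.Node)) '' H.verts ∪
      (fun e : G.Edge => (Sum.inr (Sum.inl e) : G.Node)) '' H.edges) ∪
    ({x₀} ∪ Set.range (fun γ : Γ => nodeMap (ρ γ) x₀))
  have hT₀ : T₀.Finite :=
    ((hH.1.image _).union (hH.2.image _)).union ((Set.finite_singleton x₀).union (Set.finite_range _))
  -- chosen walks from `x₀`, the union `W` of their supports, and its saturation `S` under `Γ`
  let pw : ∀ t : G.Node, G.subdivision.Walk x₀ t := fun t => (hpre x₀ t).some
  let W : Set G.Node := ⋃ t ∈ T₀, {z | z ∈ (pw t).support}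
  have hW : W.Finite := hT₀.biUnion fun t _ => (pw t).support.finite_toSet
  let S : Set G.Node := W ∪ ⋃ γ : Γ, nodeMap (ρ γ) '' W
  have hS : S.Finite := hW.union (Set.finite_iUnion fun γ => hW.image _)
  have hWS : W ⊆ S := Set.subset_union_left
  have hx₀T : x₀ ∈ T₀ := Or.inr (Or.inl rfl)
  have hmemW : ∀ t ∈ T₀, ∀ z ∈ (pw t).support, z ∈ W :=
    fun t ht z hz => Set.mem_biUnion ht hz
  have hx₀W : x₀ ∈ W := hmemW x₀ hx₀T x₀ (pw x₀).start_mem_support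
  have hSinv : ∀ (γ : Γ), ∀ z ∈ S, nodeMap (ρ γ) z ∈ S := by
    intro γ z hz
    rcases hz with hz | hz
    · exact Or.inr (Set.mem_iUnion.mpr ⟨γ, z, hz, rfl⟩)
    · obtain ⟨γ', hz⟩ := Set.mem_iUnion.mp hz
      obtain ⟨w, hw, rfl⟩ := hz
      rw [hmul]
      exact Or.inr (Set.mem_iUnion.mpr ⟨γ * γ', w, hw, rfl⟩)
  -- every node of `S` is joined to `x₀` inside `S`
  have hW' : ∀ z ∈ W, ∃ q : G.subdivision.Walk x₀ z, ∀ y ∈ q.support, y ∈ W := by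
    intro z hz
    obtain ⟨t, ht, hz⟩ := Set.mem_iUnion₂.mp hz
    exact ⟨(pw t).takeUntil z hz, fun y hy => hmemW t ht y ((pw t).support_takeUntil_subset_support hz hy)⟩
  have hreachS : ∀ z ∈ S, ∃ q : G.subdivision.Walk x₀ z, ∀ y ∈ q.support, y ∈ S := by
    intro z hz
    rcases hz with hz | hz
    · obtain ⟨q, hq⟩ := hW' z hz
      exact ⟨q, fun y hy => hWS (hq y hy)⟩
    · obtain ⟨γ, hz⟩ := Set.mem_iUnion.mp hz
      obtain ⟨w, hw, rfl⟩ := hz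
      obtain ⟨q₁, hq₁⟩ := hW' w hw
      have hγx₀ : nodeMap (ρ γ) x₀ ∈ T₀ := Or.inr (Or.inr ⟨γ, rfl⟩)
      let q₂ : G.subdivision.Walk (nodeMap (ρ γ) x₀) (nodeMap (ρ γ) w) := q₁.map (f γ)
      refine ⟨(pw (nodeMap (ρ γ) x₀)).append q₂, fun y hy => ?_⟩
      rw [SimpleGraph.Walk.mem_support_append_iff] at hy
      rcases hy with hy | hy
      · exact hWS (hmemW _ hγx₀ y hy)
      · rw [SimpleGraph.Walk.support_map, List.mem_map] at hy
        obtain ⟨y', hy', rfl⟩ := hy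
        exact Or.inr (Set.mem_iUnion.mpr ⟨γ, y', hq₁ y' hy', rfl⟩)
  -- the saturation of `S` into a sub-semi-graph
  let K : G.Subgraph := ⟨{v | (Sum.inl v : G.Node) ∈ S},
    {e | (Sum.inr (Sum.inl e) : G.Node) ∈ S ∨ ∃ b, G.edgeOf b = e ∧ (Sum.inr (Sum.inr b) : G.Node) ∈ S}⟩
  have hSK : ∀ z ∈ S, z ∈ Set.range (Sum.map K.ι.vertexMap (Sum.map K.ι.edgeMap K.ι.branchMap)) := by
    intro z hz
    rcases z with v | e | b
    · exact (K.inl_mem_range_iff v).mpr hz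
    · exact (K.edge_mem_range_iff e).mpr (Or.inl hz)
    · exact (K.branch_mem_range_iff b).mpr (Or.inr ⟨b, rfl, hz⟩)
  refine ⟨K, ⟨?_, ?_⟩, ⟨?_⟩, ⟨?_, ?_⟩, ?_⟩
  · -- finitely many vertices
    exact hS.preimage Sum.inl_injective.injOn
  · -- finitely many edges
    refine Set.Finite.subset
      ((hS.preimage (f := fun e : G.Edge => (Sum.inr (Sum.inl e) : G.Node))
        (Sum.inr_injective.comp Sum.inl_injective).injOn).union
      ((hS.preimage (f := fun b : G.Branch => (Sum.inr (Sum.inr b) : G.Node))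
        (Sum.inr_injective.comp Sum.inr_injective).injOn).image G.edgeOf)) ?_
    rintro e (he | ⟨b, rfl, hb⟩)
    · exact Or.inl he
    · exact Or.inr ⟨b, hb, rfl⟩
  · -- connected: every node over `K` is joined to `x₀` over `K`
    rw [SimpleGraph.connected_iff_exists_forall_reachable]
    obtain ⟨r₀, hr₀⟩ := hSK x₀ (hWS hx₀W)
    refine ⟨r₀, fun y => ?_⟩
    have key : ∃ q : G.subdivision.Walk x₀
        (Sum.map K.ι.vertexMap (Sum.map K.ι.edgeMap K.ι.branchMap) y),
        ∀ z ∈ q.support,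
          z ∈ Set.range (Sum.map K.ι.vertexMap (Sum.map K.ι.edgeMap K.ι.branchMap)) := by
      rcases y with ⟨v, hv⟩ | ⟨e, he⟩ | ⟨b, hb⟩
      · obtain ⟨q, hq⟩ := hreachS _ hv
        exact ⟨q, fun z hz => hSK z (hq z hz)⟩
      · rcases he with he | ⟨b, rfl, hb⟩
        · obtain ⟨q, hq⟩ := hreachS _ he
          exact ⟨q, fun z hz => hSK z (hq z hz)⟩
        · obtain ⟨q, hq⟩ := hreachS _ hb
          have hadj : G.subdivision.Adj (Sum.inr (Sum.inr b)) (Sum.inr (Sum.inl (G.edgeOf b))) :=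
            (G.subdivision_adj_of_nodeRel (NodeRel.edge_branch b)).symm
          refine ⟨q.concat hadj, fun z hz => ?_⟩
          rw [SimpleGraph.Walk.support_concat, List.mem_append, List.mem_singleton] at hz
          rcases hz with hz | rfl
          · exact hSK z (hq z hz)
          · exact (K.edge_mem_range_iff _).mpr (Or.inr ⟨b, rfl, hb⟩)
      · rcases hb with hb | ⟨b', hb'e, hb'⟩
        · obtain ⟨q, hq⟩ := hreachS _ hb
          have hadj : G.subdivision.Adj (Sum.inr (Sum.inl (G.edgeOf b))) (Sum.inr (Sum.inr b)) :=
            G.subdivision_adj_of_nodeRel (NodeRel.edge_branch b)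
          refine ⟨q.concat hadj, fun z hz => ?_⟩
          rw [SimpleGraph.Walk.support_concat, List.mem_append, List.mem_singleton] at hz
          rcases hz with hz | rfl
          · exact hSK z (hq z hz)
          · exact (K.branch_mem_range_iff _).mpr (Or.inl hb)
        · obtain ⟨q, hq⟩ := hreachS _ hb'
          have hadj₁ : G.subdivision.Adj (Sum.inr (Sum.inr b')) (Sum.inr (Sum.inl (G.edgeOf b))) := by
            rw [← hb'e]
            exact (G.subdivision_adj_of_nodeRel (NodeRel.edge_branch b')).symm
          have hadj₂ : G.subdivision.Adj (Sum.inr (Sum.inl (G.edgeOf b))) (Sum.inr (Sum.inr b)) :=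
            G.subdivision_adj_of_nodeRel (NodeRel.edge_branch b)
          refine ⟨(q.concat hadj₁).concat hadj₂, fun z hz => ?_⟩
          rw [SimpleGraph.Walk.support_concat, SimpleGraph.Walk.support_concat, List.mem_append,
            List.mem_append, List.mem_singleton, List.mem_singleton] at hz
          rcases hz with (hz | rfl) | rfl
          · exact hSK z (hq z hz)
          · exact (K.edge_mem_range_iff _).mpr (Or.inr ⟨b', hb'e, hb'⟩)
          · exact (K.branch_mem_range_iff _).mpr (Or.inr ⟨b', hb'e, hb'⟩)
    obtain ⟨q, hq⟩ := key
    exact K.reachable_of_walk q hq r₀ y hr₀ rfl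
  · -- contains the vertices of `H`
    intro v hv
    have ht : (Sum.inl v : G.Node) ∈ T₀ := Or.inl (Or.inl ⟨v, hv, rfl⟩)
    exact hWS (hmemW _ ht _ (pw _).end_mem_support)
  · -- contains the edges of `H`
    intro e he
    have ht : (Sum.inr (Sum.inl e) : G.Node) ∈ T₀ := Or.inl (Or.inr ⟨e, he, rfl⟩)
    exact Or.inl (hWS (hmemW _ ht _ (pw _).end_mem_support))
  · -- stabilized
    refine K.isStabilized_of_mapsTo ρ (fun γ v hv => ?_) (fun γ e he => ?_)
    · exact hSinv γ _ hv
    · rcases he with he | ⟨b, rfl, hb⟩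
      · exact Or.inl (hSinv γ _ he)
      · exact Or.inr ⟨(ρ γ).hom.branchMap b, (ρ γ).hom.edgeOf_branchMap b, hSinv γ _ hb⟩

end SemiGraph

end Literature.AnabelianGeometry.SemiGraphs
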